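import Summits.NavierStokesRegularity.NavierStokesRegularity.Theorems.ExtremalBiaxialitySubcritical.Negative.MaximalityFree
import Summits.NavierStokesRegularity.NavierStokesRegularity.Theorems.SqueezeCycleStrainAlgebra

/-!
# Crux `ExtremalBiaxialitySubcritical` (stmt-NavierStokesRegularity-11609), negative side:
# no slack — the two open cruxes of route `SqueezeCycle` are jointly EQUIVALENT to its target

Route `SqueezeCycle`: target `SqueezeLiouville` (X: Liouville on the Type-I model class `𝒦_C`),
open cruxes `MustSqueeze` (an element with `Λ ≤ 1/8` everywhere vanishes) and
`ExtremalBiaxialitySubcritical` (an attained class maximum of `Λ` is `< 1/8`), support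
`ExtremalElementExists` (PROVED, p70643). Extracted from the crux work file
`Cruxes/ExtremalBiaxialitySubcritical/Disproof.lean` (cdisprove adversary, generation 3, D-0016).

With `ExtremalElementExists` a theorem, the deciding dichotomy `closes` (step 1) and the trivial
converse directions give an exact logical picture, recorded here for planners and provers:

* `squeezeLiouville_iff_mustSqueeze_and_crux` — **X ⇔ MustSqueeze ∧ ExtremalBiaxialitySubcritical**:
  the two open cruxes PARTITION the target with no slack; at least one of them is exactly as hard
  as the Type-I Liouville problem, and which one depends only on the (unknown) values of the
  Leray-gauge middle strain eigenvalue on hypothetical nontrivial Type-I ancient solutions.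
* `crux_iff_squeezeLiouville` — under `MustSqueeze` the crux IS the target;
  `mustSqueeze_iff_squeezeLiouville` — under the crux `MustSqueeze` IS the target.
* `squeezeLiouville_iff_forall_lerayMiddleStrain_lt_quarter` — given the `MustSqueeze` family for
  every threshold `a < 1/4` (the sibling crux's engine, hypothesis `hMS` as in the tree's
  `extremalBiaxialitySubcritical_bootstrap`), the TARGET itself is equivalent to the a-priori bound
  "`Λ_u(t,x) = (−t)λ₂(sym ∇u(t,x)) < 1/4` at every point of every element of every `𝒦_C`": the
  route reduces Type-I Liouville to a pointwise middle-eigenvalue bound at the quarter threshold,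
  and to nothing less.
* **How much the picked line's bootstrap buys** (line `quarter-bootstrap-pinning`, whose open stub
  `stub_largeExcessExclusion` is the crux restricted to attained maxima with
  `1/4 ≤ m − 2m³/K²`, `K = K(C)` the class-uniform gauge strain bound, `6m² ≤ K²` forced at the
  record): `cubicCeiling_eq_of_pinned` — the cubic production ceiling `stub_cubicProductionBound`
  holds with EQUALITY whenever `λ₂ = m` and `|S| = K` (so its excess `b = m − 2m³/K²` cannot be
  improved by sl(3) algebra; every such pinned datum is realised identically in space-time by an
  exact self-similar strain flow, `Negative/SelfSimilarStrain`); `largeExcess_of_three_eighths_le`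
  — the open regime contains EVERY attained `m ≥ 3/8`, whatever `K`; `largeExcess_of_strainFloor`
  — if moreover `K² ≥ 3/2` (forced as soon as the class is nontrivial by the no-slack fact
  `sup (−t)λ₁ ≥ 1` of the sibling item `SmallStrainRung`/triage r1-2 K1, since
  `|S|² ≥ (3/2)λ₁²` on trace-free strains), it contains every attained `m ≥ 7/25 = 0.28`;
  `largeExcess_of_window` — in general it contains `m` as soon as `2m³ ≤ (m − 1/4)K²`. So the
  three true stubs dispose only of attained maxima in the sliver `[1/4, 0.28)` (and of nothing at
  all once `K(C)² ≥ 2·0.28³/0.03 ≈ 1.47`, i.e. always, given no-slack): modulo its true stubs the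
  line's open stub is the crux on `m ≥ 0.28` — `promote-stub` is the expected ending, as the lead
  predicted, and the sliver is the only place where new mathematics entered.
-/

noncomputable section

open Set Function Filter MeasureTheory
open scoped RealInnerProductSpace Matrix

namespace Summit.NavierStokesRegularity.NavierStokesRegularity.Theorems.ExtremalBiaxialitySubcritical.Negative

open Literature.Analysis.FluidPDE
open Summit.NavierStokesRegularity.NavierStokesRegularity.Theses

/-- **No slack: `SqueezeLiouville ⇔ MustSqueeze ∧ ExtremalBiaxialitySubcritical`.** `⇒`: a
vanishing field satisfies both (`extremalBiaxialitySubcritical_of_squeezeLiouville`). `⇐`: the crux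
gives `Λ < 1/8` everywhere on every class (`withoutMaximality_of_crux`, via the proved
`ExtremalElementExists`), which is the hypothesis of `MustSqueeze`
(`squeezeLiouville_of_mustSqueeze_of_withoutMaximality`). [folklore] -/
theorem squeezeLiouville_iff_mustSqueeze_and_crux :
    SqueezeCycle.SqueezeLiouville ↔ SqueezeCycle.MustSqueeze ∧ SqueezeCycle.ExtremalBiaxialitySubcritical := by
  constructor
  · intro hL
    exact ⟨fun C u hu _ => hL C u hu, extremalBiaxialitySubcritical_of_squeezeLiouville hL⟩
  · rintro ⟨hM, hX⟩
    exact squeezeLiouville_of_mustSqueeze_of_withoutMaximality hM (withoutMaximality_of_crux hX)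

/-- **Under `MustSqueeze` the crux is the route target in other words.** [folklore] -/
theorem crux_iff_squeezeLiouville (hM : SqueezeCycle.MustSqueeze) :
    SqueezeCycle.ExtremalBiaxialitySubcritical ↔ SqueezeCycle.SqueezeLiouville :=
  ⟨fun hX => squeezeLiouville_iff_mustSqueeze_and_crux.2 ⟨hM, hX⟩,
    extremalBiaxialitySubcritical_of_squeezeLiouville⟩

/-- **Under the crux `MustSqueeze` is the route target in other words.** [folklore] -/
theorem mustSqueeze_iff_squeezeLiouville (hX : SqueezeCycle.ExtremalBiaxialitySubcritical) :
    SqueezeCycle.MustSqueeze ↔ SqueezeCycle.SqueezeLiouville :=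
  ⟨fun hM => squeezeLiouville_iff_mustSqueeze_and_crux.2 ⟨hM, hX⟩,
    fun hL => (squeezeLiouville_iff_mustSqueeze_and_crux.1 hL).1⟩

/-- **The target as a quarter a-priori bound.** Given the `MustSqueeze` family for every
threshold `a < 1/4`, Liouville on the Type-I model class holds iff the Leray-gauge middle strain
eigenvalue of every element of every `𝒦_C` is `< 1/4` at every point
(`crux_iff_forall_lerayMiddleStrain_lt_quarter` and `squeezeLiouville_iff_mustSqueeze_and_crux`,
`MustSqueeze` being the member `a = 1/8` of the family). [folklore] -/
theorem squeezeLiouville_iff_forall_lerayMiddleStrain_lt_quarter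
    (hMS : ∀ a : ℝ, a < 1 / 4 → ∀ (C : ℝ) (u : ℝ → EuclideanSpace ℝ (Fin 3) → EuclideanSpace ℝ (Fin 3)), ContDiffOn ℝ (⊤ : ℕ∞) (Function.uncurry u) (Set.Iio 0 ×ˢ Set.univ) ∧ (∀ t < 0, Literature.Analysis.FluidPDE.VectorCalculus.IsDivFree (u t)) ∧ (∀ s t : ℝ, s < t → t < 0 → ∀ x, u t x = Literature.Analysis.FluidPDE.heatFlow (u s) (t-s) x - ∫ τ in Set.Ioo s t, ∫ y, ((-(inner ℝ (x-y) (u τ y) / (2*(t-τ)) * Literature.Analysis.UnboundedOperators.heatKernel (t-τ) (x-y))) • u τ y + (∫ σ in Set.Ioi (t-τ), Literature.Analysis.UnboundedOperators.heatKernel σ (x-y) / (4*σ^2)) • (inner ℝ (x-y) (u τ y) • u τ y + inner ℝ (u τ y) (u τ y) • (x-y) + inner ℝ (x-y) (u τ y) • u τ y) - ((∫ σ in Set.Ioi (t-τ), Literature.Analysis.UnboundedOperators.heatKernel σ (x-y) / (8*σ^3)) * (inner ℝ (x-y) (u τ y) * inner ℝ (x-y) (u τ y))) • (x-y))) ∧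 Literature.Analysis.FluidPDE.HasTypeITimeDecay C u ∧ (∀ (x₀ : EuclideanSpace ℝ (Fin 3)) (t₀ r : ℝ), t₀ ≤ 0 → 0 < r → (∀ t, t₀ - r^2 < t → t < t₀ → r⁻¹ * ∫ x in Metric.ball x₀ r, ‖u t x‖^2 ≤ C) ∧ r⁻¹ * ∫ t in Set.Ioo (t₀ - r^2) t₀, ∫ x in Metric.ball x₀ r, ‖fderiv ℝ (u t) x‖^2 ≤ C) → (∀ t < 0, ∀ x, (∃ v w : EuclideanSpace ℝ (Fin 3), ‖v‖ = 1 ∧ ‖w‖ = 1 ∧ inner ℝ v w = 0 ∧ ∀ α β : ℝ, (-t) * inner ℝ (fderiv ℝ (u t) x (α • v + β • w)) (α • v + β • w) ≤ a * (α^2 + β^2))) → ∀ t < 0, ∀ x, u t x = 0) :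
    SqueezeCycle.SqueezeLiouville ↔
      ∀ (C : ℝ) (u : ℝ → EuclideanSpace ℝ (Fin 3) → EuclideanSpace ℝ (Fin 3)), (ContDiffOn ℝ (⊤ : ℕ∞) (Function.uncurry u) (Set.Iio 0 ×ˢ Set.univ) ∧ (∀ t < 0, Literature.Analysis.FluidPDE.VectorCalculus.IsDivFree (u t)) ∧ (∀ s t : ℝ, s < t → t < 0 → ∀ x, u t x = Literature.Analysis.FluidPDE.heatFlow (u s) (t-s) x - ∫ τ in Set.Ioo s t, ∫ y, ((-(inner ℝ (x-y) (u τ y) / (2*(t-τ)) * Literature.Analysis.UnboundedOperators.heatKernel (t-τ) (x-y))) • u τ y + (∫ σ in Set.Ioi (t-τ), Literature.Analysis.UnboundedOperators.heatKernel σ (x-y) / (4*σ^2)) • (inner ℝ (x-y) (u τ y) • u τ y + inner ℝ (u τ y) (u τ y) • (x-y) + inner ℝ (x-y) (u τ y) • u τ y) - ((∫ σ in Set.Ioi (t-τ), Literature.Analysis.UnboundedOperators.heatKernel σ (x-y) / (8*σ^3)) * (inner ℝ (x-y) (u τ y) * inner ℝ (x-y) (u τ y))) • (x-y))) ∧ Literature.Analysis.FluidPDE.HasTypeITimeDecay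 C u ∧ (∀ (x₀ : EuclideanSpace ℝ (Fin 3)) (t₀ r : ℝ), t₀ ≤ 0 → 0 < r → (∀ t, t₀ - r^2 < t → t < t₀ → r⁻¹ * ∫ x in Metric.ball x₀ r, ‖u t x‖^2 ≤ C) ∧ r⁻¹ * ∫ t in Set.Ioo (t₀ - r^2) t₀, ∫ x in Metric.ball x₀ r, ‖fderiv ℝ (u t) x‖^2 ≤ C)) →
        ∀ t < 0, ∀ x, lerayMiddleStrain u t x < 1 / 4 := by
  have hM : SqueezeCycle.MustSqueeze := hMS (1 / 8) (by norm_num)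
  rw [← crux_iff_forall_lerayMiddleStrain_lt_quarter hMS]
  exact ⟨extremalBiaxialitySubcritical_of_squeezeLiouville,
    fun hX => squeezeLiouville_iff_mustSqueeze_and_crux.2 ⟨hM, hX⟩⟩


/-! ### How much the quarter bootstrap buys (line `quarter-bootstrap-pinning`) -/

/-- **The cubic ceiling is attained on pinned data.** For a trace-free `A` with
`S = ½(A + Aᵀ)`, middle eigenvalue `μ₁(A + Aᵀ) = 2m` (i.e. `λ₂(S) = m`) and `∑ Sᵢⱼ² = K²`, the
inequality of `stub_cubicProductionBound` is an equality:
`−4 det S = (2m − 4m³/K²)·∑ Sᵢⱼ²` (`production_identity`). The excess `b = m − 2m³/K²` of the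
bootstrap is therefore algebraically sharp. [folklore] -/
theorem cubicCeiling_eq_of_pinned (A : Matrix (Fin 3) (Fin 3) ℝ) (hA : A.trace = 0) {m K : ℝ}
    (hK : 0 < K) (hμ : (Matrix.isHermitian_add_transpose_self A).eigenvalues₀ 1 = 2 * m)
    (hσ : (∑ i, ∑ j, (((1 / 2 : ℝ) • (A + Aᵀ)) i j) ^ 2) = K ^ 2) :
    -4 * (((1 / 2 : ℝ) • (A + Aᵀ))).det =
      (2 * m - 4 * m ^ 3 / K ^ 2) * (∑ i, ∑ j, (((1 / 2 : ℝ) • (A + Aᵀ)) i j) ^ 2) := by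
  rw [production_identity A hA, hμ, hσ]
  field_simp
  ring

/-- **The open regime contains every attained `m ≥ 3/8`**: `0 < K`, `6m² ≤ K²` (forced at the
record by `six_mul_midStrain_sq_le`) and `3/8 ≤ m` give `1/4 ≤ m − 2m³/K²`
(`2m³/K² ≤ m/3`). [folklore] -/
theorem largeExcess_of_three_eighths_le {m K : ℝ} (hK : 0 < K) (h6 : 6 * m ^ 2 ≤ K ^ 2)
    (hm : 3 / 8 ≤ m) : 1 / 4 ≤ m - 2 * m ^ 3 / K ^ 2 := by
  have hK2 : 0 < K ^ 2 := by positivity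
  have h1 : 2 * m ^ 3 / K ^ 2 ≤ m / 3 := by
    rw [div_le_iff₀ hK2]
    nlinarith
  linarith

/-- **With the no-slack strain floor `K² ≥ 3/2` the open regime contains every attained
`m ∈ [7/25, 3/8]`** (hence, with `largeExcess_of_three_eighths_le`, every `m ≥ 0.28`):
`2m³/K² ≤ 4m³/3` and `m − 4m³/3 ≥ 1/4` on `[0.28, 0.375]` (concavity; the left end is within
`10⁻³` of equality). The floor `3/2` is `(3/2)·λ₁²` at a point with `(−t)λ₁ ≥ 1`, which every
nontrivial class has by the vorticity maximum principle (sibling item `SmallStrainRung`). [folklore] -/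
theorem largeExcess_of_strainFloor {m K : ℝ} (hK : 3 / 2 ≤ K ^ 2) (hm : 7 / 25 ≤ m)
    (hm' : m ≤ 3 / 8) : 1 / 4 ≤ m - 2 * m ^ 3 / K ^ 2 := by
  have hK2 : 0 < K ^ 2 := by linarith
  have hm0 : 0 ≤ m := by linarith
  have h1 : 2 * m ^ 3 / K ^ 2 ≤ 4 * m ^ 3 / 3 := by
    rw [div_le_iff₀ hK2]
    nlinarith [pow_nonneg hm0 3]
  nlinarith [mul_nonneg (sub_nonneg.2 hm) (sub_nonneg.2 hm'),
    mul_nonneg hm0 (mul_nonneg (sub_nonneg.2 hm) (sub_nonneg.2 hm'))]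

/-- **The general window**: the open regime contains `m` as soon as `2m³ ≤ (m − 1/4)K²`; the
bootstrap can only dispose of attained maxima `m ∈ [1/4, m_K)` with `2m_K³ = (m_K − 1/4)K²`,
`m_K − 1/4 ≈ 1/(32K²)` for large `K`. [folklore] -/
theorem largeExcess_of_window {m K : ℝ} (hK : 0 < K) (h : 2 * m ^ 3 ≤ (m - 1 / 4) * K ^ 2) :
    1 / 4 ≤ m - 2 * m ^ 3 / K ^ 2 := by
  have hK2 : 0 < K ^ 2 := by positivity
  have h1 : 2 * m ^ 3 / K ^ 2 ≤ m - 1 / 4 := by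
    rw [div_le_iff₀ hK2]; linarith
  linarith

end Summit.NavierStokesRegularity.NavierStokesRegularity.Theorems.ExtremalBiaxialitySubcritical.Negative

end
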